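import Mathlib
import Summits.ValiantsHypothesis.ValiantsHypothesis.Theorems.LacunarySymmetroidMatrixDescartesDominantMiddle

/-!
# `MatrixDescartes` (stmt-ValiantsHypothesis-18050) — pivot-valley law, SCALAR CORE: cross-pivot domination

HONEST FRAMING.  Cell `pub-symmetroid`, seat `val-sym-mdr-p2` (gen 5); helper file `--supports` the crux
`Theses.LacunarySymmetroid.MatrixDescartes`.  Elementary real inequalities for the companion file `…PivotValley`
(the PIVOT-VALLEY LAW for two-sided words with one free letter); nothing here bears on the crux, on `stub_twoSided`,
on `DoorA26` / `DoorA34`, or on `VP ≠ VNP`.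

CONTENT.  With a pivot exponent `d_π` and scalars `q_l ≥ 0` off the pivot exponent, the normalised family
`g(u) = ∑ₗ u^{d_l − d_π} q_l` is non-increasing on `(0, x₁]` as soon as the below-pivot terms dominate the above-pivot
terms in the derivative sense AT `x₁` (`scalar_anti_left`), and non-decreasing on `[x₂, ∞)` under the mirror
dominance at `x₂` (`scalar_mono_right`): termwise `t^k − s^k ≤ k·x₁^{k−1}(t−s)` above and
`s^{−m} − t^{−m} ≥ m·x₁^{−m−1}(t−s)` below for `s ≤ t ≤ x₁` (mirror bounds for `x₂ ≤ s ≤ t`), so the dominance at the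
endpoint propagates into the flank.  Unlike the tree's `DominatedWindow.scalar_nonneg*` (far blocks dominated by an
adjacent letter on the SAME side of the pivot) this is CROSS-pivot domination, the shape needed when the pivot letter
is free and all other letters are positive semidefinite.
[folklore] Elementary; Mathlib + `DominantMiddle.pow_sub_pow_window/_ge`, `coeff_above/below`; axioms `propext`,
`Classical.choice`, `Quot.sound`.
-/

-- layout Summits/ValiantsHypothesis/ValiantsHypothesis forces the duplicated namespace component
set_option linter.dupNamespace false

namespace Summit.ValiantsHypothesis.ValiantsHypothesis.Theorems.LacunarySymmetroidMatrixDescartes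

open Polynomial Matrix Finset
open scoped BigOperators

namespace PivotValley

variable {K : ℕ}

/-- `t^k − s^k ≤ k·x₁^{k−1}·(t − s)` for `0 ≤ s ≤ t ≤ x₁`, written with `k = k' + 1`. [folklore] -/
theorem pow_sub_pow_le_top {s t x₁ : ℝ} (hs : 0 ≤ s) (hst : s ≤ t) (htx : t ≤ x₁) (k' : ℕ) :
    t ^ (k' + 1) - s ^ (k' + 1) ≤ ((k' : ℝ) + 1) * x₁ ^ k' * (t - s) := by
  have h := DominantMiddle.pow_sub_pow_window hs hst htx 1 k' le_rfl
  simp only [Nat.cast_one, one_mul, pow_one] at h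
  rw [add_comm 1 k'] at h
  linarith [h]

/-- `t^k − s^k ≥ k·x₂^{k−1}·(t − s)` for `0 ≤ x₂ ≤ s ≤ t`, written with `k = k' + 1`. [folklore] -/
theorem pow_sub_pow_ge_bot {s t x₂ : ℝ} (hx₂ : 0 ≤ x₂) (hxs : x₂ ≤ s) (hst : s ≤ t) (k' : ℕ) :
    ((k' : ℝ) + 1) * x₂ ^ k' * (t - s) ≤ t ^ (k' + 1) - s ^ (k' + 1) := by
  have h := DominantMiddle.pow_sub_pow_ge s t (hx₂.trans hxs) hst k'
  have h2 : x₂ ^ k' ≤ s ^ k' := pow_le_pow_left₀ hx₂ hxs k'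
  have h3 : 0 ≤ t - s := sub_nonneg.2 hst
  have h4 : ((k' : ℝ) + 1) * x₂ ^ k' * (t - s) ≤ ((k' : ℝ) + 1) * s ^ k' * (t - s) :=
    mul_le_mul_of_nonneg_right (mul_le_mul_of_nonneg_left h2 (by positivity)) h3
  exact h4.trans h

/-- `(s^m)⁻¹ − (t^m)⁻¹ ≥ m·(x₁^{m+1})⁻¹·(t − s)` for `0 < s ≤ t ≤ x₁`, written with `m = m' + 1`. [folklore] -/
theorem inv_pow_sub_ge_top {s t x₁ : ℝ} (hs : 0 < s) (hst : s ≤ t) (htx : t ≤ x₁) (m' : ℕ) :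
    ((m' : ℝ) + 1) * (x₁ ^ (m' + 2))⁻¹ * (t - s) ≤ (s ^ (m' + 1))⁻¹ - (t ^ (m' + 1))⁻¹ := by
  have ht : 0 < t := hs.trans_le hst
  have hx₁ : 0 < x₁ := ht.trans_le htx
  have key := DominantMiddle.pow_sub_pow_ge s t hs.le hst m'
  -- `(m'+1) s^{m'} (t−s) ≤ t^{m'+1} − s^{m'+1}`
  have hprod : s * t ^ (m' + 1) ≤ x₁ ^ (m' + 2) := by
    rw [pow_succ x₁ (m' + 1), mul_comm (x₁ ^ (m' + 1))]
    exact mul_le_mul (hst.trans htx) (pow_le_pow_left₀ ht.le htx _) (by positivity) hx₁.le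
  have hst' : 0 ≤ t - s := sub_nonneg.2 hst
  have hpos : 0 < s * t ^ (m' + 1) := by positivity
  calc ((m' : ℝ) + 1) * (x₁ ^ (m' + 2))⁻¹ * (t - s)
      ≤ ((m' : ℝ) + 1) * (s * t ^ (m' + 1))⁻¹ * (t - s) :=
        mul_le_mul_of_nonneg_right (mul_le_mul_of_nonneg_left (inv_anti₀ hpos hprod) (by positivity)) hst'
    _ = (((m' : ℝ) + 1) * s ^ m' * (t - s)) * (s ^ (m' + 1) * t ^ (m' + 1))⁻¹ := by
        field_simp
        ring
    _ ≤ (t ^ (m' + 1) - s ^ (m' + 1)) * (s ^ (m' + 1) * t ^ (m' + 1))⁻¹ :=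
        mul_le_mul_of_nonneg_right key (by positivity)
    _ = (s ^ (m' + 1))⁻¹ - (t ^ (m' + 1))⁻¹ := by
        rw [inv_sub_inv (pow_ne_zero _ hs.ne') (pow_ne_zero _ ht.ne')]
        ring

/-- `(s^m)⁻¹ − (t^m)⁻¹ ≤ m·(x₂^{m+1})⁻¹·(t − s)` for `0 < x₂ ≤ s ≤ t`, written with `m = m' + 1`. [folklore] -/
theorem inv_pow_sub_le_bot {s t x₂ : ℝ} (hx₂ : 0 < x₂) (hxs : x₂ ≤ s) (hst : s ≤ t) (m' : ℕ) :
    (s ^ (m' + 1))⁻¹ - (t ^ (m' + 1))⁻¹ ≤ ((m' : ℝ) + 1) * (x₂ ^ (m' + 2))⁻¹ * (t - s) := by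
  have hs : 0 < s := hx₂.trans_le hxs
  have ht : 0 < t := hs.trans_le hst
  -- `t^{m'+1} − s^{m'+1} ≤ (m'+1) t^{m'} (t − s)`  (window lemma with `x₁ := t`)
  have key : t ^ (m' + 1) - s ^ (m' + 1) ≤ ((m' : ℝ) + 1) * t ^ m' * (t - s) :=
    pow_sub_pow_le_top hs.le hst le_rfl m'
  have hprod : x₂ ^ (m' + 2) ≤ s ^ (m' + 1) * t := by
    rw [pow_succ x₂ (m' + 1)]
    exact mul_le_mul (pow_le_pow_left₀ hx₂.le hxs _) (hxs.trans hst) hx₂.le (by positivity)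
  have hst' : 0 ≤ t - s := sub_nonneg.2 hst
  have hpos : 0 < x₂ ^ (m' + 2) := by positivity
  calc (s ^ (m' + 1))⁻¹ - (t ^ (m' + 1))⁻¹
      = (t ^ (m' + 1) - s ^ (m' + 1)) * (s ^ (m' + 1) * t ^ (m' + 1))⁻¹ := by
        rw [inv_sub_inv (pow_ne_zero _ hs.ne') (pow_ne_zero _ ht.ne')]
        ring
    _ ≤ (((m' : ℝ) + 1) * t ^ m' * (t - s)) * (s ^ (m' + 1) * t ^ (m' + 1))⁻¹ :=
        mul_le_mul_of_nonneg_right key (by positivity)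
    _ = ((m' : ℝ) + 1) * (s ^ (m' + 1) * t)⁻¹ * (t - s) := by
        field_simp
        ring
    _ ≤ ((m' : ℝ) + 1) * (x₂ ^ (m' + 2))⁻¹ * (t - s) :=
        mul_le_mul_of_nonneg_right (mul_le_mul_of_nonneg_left (inv_anti₀ hpos hprod) (by positivity)) hst'

/-- **Left flank (scalar).**  Pivot exponent `d π`; `q l ≥ 0` off the pivot exponent.  If at `x₁` the below-pivot
decrease dominates the above-pivot increase, `∑_{d_l>d_π}(d_l−d_π)x₁^{d_l}q_l ≤ ∑_{d_l<d_π}(d_π−d_l)x₁^{d_l}q_l`, then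
for `0 < s ≤ t ≤ x₁`: `∑ₗ (s^{d_l}/s^{d_π} − t^{d_l}/t^{d_π})·q_l ≥ 0`. [folklore] -/
theorem scalar_anti_left (d : Fin K → ℕ) (π : Fin K) (q : Fin K → ℝ) (hq : ∀ l, d l ≠ d π → 0 ≤ q l)
    (x₁ : ℝ) (hx₁ : 0 < x₁)
    (hdom : ∑ l ∈ univ.filter (fun l => d π < d l), ((d l - d π : ℕ) : ℝ) * x₁ ^ d l * q l
      ≤ ∑ l ∈ univ.filter (fun l => d l < d π), ((d π - d l : ℕ) : ℝ) * x₁ ^ d l * q l)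
    {s t : ℝ} (hs : 0 < s) (hst : s ≤ t) (htx : t ≤ x₁) :
    0 ≤ ∑ l, (s ^ d l * (s ^ d π)⁻¹ - t ^ d l * (t ^ d π)⁻¹) * q l := by
  have ht : 0 < t := hs.trans_le hst
  set f : Fin K → ℝ := fun l => (s ^ d l * (s ^ d π)⁻¹ - t ^ d l * (t ^ d π)⁻¹) * q l with hf
  set c : ℝ := (t - s) * x₁⁻¹ * (x₁ ^ d π)⁻¹ with hc
  have hc0 : 0 ≤ c := by
    have : 0 ≤ t - s := sub_nonneg.2 hst
    positivity
  -- three-way split of the sum: above / below / at the pivot exponent (zero)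
  have hsplit : ∀ l, f l = (if d π < d l then f l else 0) + (if d l < d π then f l else 0) := by
    intro l
    by_cases h1 : d π < d l
    · have h2 : ¬ d l < d π := fun h => lt_asymm h1 h
      simp [h1, h2]
    · by_cases h2 : d l < d π
      · simp [h1, h2]
      · have he : d l = d π := by omega
        have hz : f l = 0 := by
          simp only [hf, he, mul_inv_cancel₀ (pow_ne_zero _ hs.ne'), mul_inv_cancel₀ (pow_ne_zero _ ht.ne'),
            sub_self, zero_mul]
        simp [h1, h2, hz]
  have hsum : ∑ l, f l = ∑ l ∈ univ.filter (fun l => d π < d l), f l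
      + ∑ l ∈ univ.filter (fun l => d l < d π), f l := by
    rw [Finset.sum_filter, Finset.sum_filter, ← Finset.sum_add_distrib]
    exact Finset.sum_congr rfl fun l _ => hsplit l
  -- above the pivot: `f l ≥ −c·(d_l−d_π)·x₁^{d_l}·q_l`
  have hA : ∀ l ∈ univ.filter (fun l => d π < d l),
      -(c * (((d l - d π : ℕ) : ℝ) * x₁ ^ d l * q l)) ≤ f l := by
    intro l hl
    have hlt : d π < d l := (Finset.mem_filter.1 hl).2
    obtain ⟨k', hk'⟩ := Nat.exists_eq_add_of_lt hlt
    have hk : d l - d π = k' + 1 := by omega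
    have hql : 0 ≤ q l := hq l (by omega)
    simp only [hf]
    rw [DominantMiddle.coeff_above hs.ne' hlt.le, DominantMiddle.coeff_above ht.ne' hlt.le, hk]
    have hkey := pow_sub_pow_le_top hs.le hst htx k'
    have ex : x₁ ^ d l = x₁ ^ d π * x₁ ^ k' * x₁ := by
      rw [show d l = d π + k' + 1 by omega, pow_succ, pow_add]
    have ec : c * ((((k' + 1 : ℕ) : ℝ)) * x₁ ^ d l * q l) = ((k' : ℝ) + 1) * x₁ ^ k' * (t - s) * q l := by
      rw [ex, hc]
      field_simp
      push_cast
      ring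
    rw [ec]
    nlinarith [mul_le_mul_of_nonneg_right hkey hql]
  -- below the pivot: `f l ≥ c·(d_π−d_l)·x₁^{d_l}·q_l`
  have hB : ∀ l ∈ univ.filter (fun l => d l < d π),
      c * (((d π - d l : ℕ) : ℝ) * x₁ ^ d l * q l) ≤ f l := by
    intro l hl
    have hlt : d l < d π := (Finset.mem_filter.1 hl).2
    obtain ⟨m', hm'⟩ := Nat.exists_eq_add_of_lt hlt
    have hm : d π - d l = m' + 1 := by omega
    have hql : 0 ≤ q l := hq l (by omega)
    simp only [hf]
    rw [DominantMiddle.coeff_below hs.ne' hlt.le, DominantMiddle.coeff_below ht.ne' hlt.le, hm]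
    have hkey := inv_pow_sub_ge_top hs hst htx m'
    have ex : x₁ ^ d π = x₁ ^ d l * x₁ ^ m' * x₁ := by
      rw [show d π = d l + m' + 1 by omega, pow_succ, pow_add]
    have ec : c * ((((m' + 1 : ℕ) : ℝ)) * x₁ ^ d l * q l)
        = ((m' : ℝ) + 1) * (x₁ ^ (m' + 2))⁻¹ * (t - s) * q l := by
      rw [hc, ex]
      field_simp
      push_cast
      ring
    rw [ec]
    nlinarith [mul_le_mul_of_nonneg_right hkey hql]
  -- assemble
  have hsumA : -(c * ∑ l ∈ univ.filter (fun l => d π < d l), ((d l - d π : ℕ) : ℝ) * x₁ ^ d l * q l)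
      ≤ ∑ l ∈ univ.filter (fun l => d π < d l), f l := by
    rw [Finset.mul_sum, ← Finset.sum_neg_distrib]
    exact Finset.sum_le_sum hA
  have hsumB : c * ∑ l ∈ univ.filter (fun l => d l < d π), ((d π - d l : ℕ) : ℝ) * x₁ ^ d l * q l
      ≤ ∑ l ∈ univ.filter (fun l => d l < d π), f l := by
    rw [Finset.mul_sum]
    exact Finset.sum_le_sum hB
  have hfin := mul_le_mul_of_nonneg_left hdom hc0
  rw [hsum]
  linarith

/-- **Right flank (scalar).**  If at `x₂` the above-pivot increase dominates the below-pivot decrease,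
`∑_{d_l<d_π}(d_π−d_l)x₂^{d_l}q_l ≤ ∑_{d_l>d_π}(d_l−d_π)x₂^{d_l}q_l`, then for `x₂ ≤ s ≤ t` (`0 < x₂`):
`∑ₗ (t^{d_l}/t^{d_π} − s^{d_l}/s^{d_π})·q_l ≥ 0`. [folklore] -/
theorem scalar_mono_right (d : Fin K → ℕ) (π : Fin K) (q : Fin K → ℝ) (hq : ∀ l, d l ≠ d π → 0 ≤ q l)
    (x₂ : ℝ) (hx₂ : 0 < x₂)
    (hdom : ∑ l ∈ univ.filter (fun l => d l < d π), ((d π - d l : ℕ) : ℝ) * x₂ ^ d l * q l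
      ≤ ∑ l ∈ univ.filter (fun l => d π < d l), ((d l - d π : ℕ) : ℝ) * x₂ ^ d l * q l)
    {s t : ℝ} (hxs : x₂ ≤ s) (hst : s ≤ t) :
    0 ≤ ∑ l, (t ^ d l * (t ^ d π)⁻¹ - s ^ d l * (s ^ d π)⁻¹) * q l := by
  have hs : 0 < s := hx₂.trans_le hxs
  have ht : 0 < t := hs.trans_le hst
  set f : Fin K → ℝ := fun l => (t ^ d l * (t ^ d π)⁻¹ - s ^ d l * (s ^ d π)⁻¹) * q l with hf
  set c : ℝ := (t - s) * x₂⁻¹ * (x₂ ^ d π)⁻¹ with hc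
  have hc0 : 0 ≤ c := by
    have : 0 ≤ t - s := sub_nonneg.2 hst
    positivity
  have hsplit : ∀ l, f l = (if d π < d l then f l else 0) + (if d l < d π then f l else 0) := by
    intro l
    by_cases h1 : d π < d l
    · have h2 : ¬ d l < d π := fun h => lt_asymm h1 h
      simp [h1, h2]
    · by_cases h2 : d l < d π
      · simp [h1, h2]
      · have he : d l = d π := by omega
        have hz : f l = 0 := by
          simp only [hf, he, mul_inv_cancel₀ (pow_ne_zero _ hs.ne'), mul_inv_cancel₀ (pow_ne_zero _ ht.ne'),
            sub_self, zero_mul]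
        simp [h1, h2, hz]
  have hsum : ∑ l, f l = ∑ l ∈ univ.filter (fun l => d π < d l), f l
      + ∑ l ∈ univ.filter (fun l => d l < d π), f l := by
    rw [Finset.sum_filter, Finset.sum_filter, ← Finset.sum_add_distrib]
    exact Finset.sum_congr rfl fun l _ => hsplit l
  -- above the pivot: `f l ≥ c·(d_l−d_π)·x₂^{d_l}·q_l`
  have hA : ∀ l ∈ univ.filter (fun l => d π < d l),
      c * (((d l - d π : ℕ) : ℝ) * x₂ ^ d l * q l) ≤ f l := by
    intro l hl
    have hlt : d π < d l := (Finset.mem_filter.1 hl).2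
    obtain ⟨k', hk'⟩ := Nat.exists_eq_add_of_lt hlt
    have hk : d l - d π = k' + 1 := by omega
    have hql : 0 ≤ q l := hq l (by omega)
    simp only [hf]
    rw [DominantMiddle.coeff_above hs.ne' hlt.le, DominantMiddle.coeff_above ht.ne' hlt.le, hk]
    have hkey := pow_sub_pow_ge_bot hx₂.le hxs hst k'
    have ex : x₂ ^ d l = x₂ ^ d π * x₂ ^ k' * x₂ := by
      rw [show d l = d π + k' + 1 by omega, pow_succ, pow_add]
    have ec : c * ((((k' + 1 : ℕ) : ℝ)) * x₂ ^ d l * q l) = ((k' : ℝ) + 1) * x₂ ^ k' * (t - s) * q l := by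
      rw [ex, hc]
      field_simp
      push_cast
      ring
    rw [ec]
    nlinarith [mul_le_mul_of_nonneg_right hkey hql]
  -- below the pivot: `f l ≥ −c·(d_π−d_l)·x₂^{d_l}·q_l`
  have hB : ∀ l ∈ univ.filter (fun l => d l < d π),
      -(c * (((d π - d l : ℕ) : ℝ) * x₂ ^ d l * q l)) ≤ f l := by
    intro l hl
    have hlt : d l < d π := (Finset.mem_filter.1 hl).2
    obtain ⟨m', hm'⟩ := Nat.exists_eq_add_of_lt hlt
    have hm : d π - d l = m' + 1 := by omega
    have hql : 0 ≤ q l := hq l (by omega)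
    simp only [hf]
    rw [DominantMiddle.coeff_below hs.ne' hlt.le, DominantMiddle.coeff_below ht.ne' hlt.le, hm]
    have hkey := inv_pow_sub_le_bot hx₂ hxs hst m'
    have ex : x₂ ^ d π = x₂ ^ d l * x₂ ^ m' * x₂ := by
      rw [show d π = d l + m' + 1 by omega, pow_succ, pow_add]
    have ec : c * ((((m' + 1 : ℕ) : ℝ)) * x₂ ^ d l * q l)
        = ((m' : ℝ) + 1) * (x₂ ^ (m' + 2))⁻¹ * (t - s) * q l := by
      rw [hc, ex]
      field_simp
      push_cast
      ring
    rw [ec]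
    nlinarith [mul_le_mul_of_nonneg_right hkey hql]
  have hsumA : c * ∑ l ∈ univ.filter (fun l => d π < d l), ((d l - d π : ℕ) : ℝ) * x₂ ^ d l * q l
      ≤ ∑ l ∈ univ.filter (fun l => d π < d l), f l := by
    rw [Finset.mul_sum]
    exact Finset.sum_le_sum hA
  have hsumB : -(c * ∑ l ∈ univ.filter (fun l => d l < d π), ((d π - d l : ℕ) : ℝ) * x₂ ^ d l * q l)
      ≤ ∑ l ∈ univ.filter (fun l => d l < d π), f l := by
    rw [Finset.mul_sum, ← Finset.sum_neg_distrib]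
    exact Finset.sum_le_sum hB
  have hfin := mul_le_mul_of_nonneg_left hdom hc0
  rw [hsum]
  linarith

end PivotValley

end Summit.ValiantsHypothesis.ValiantsHypothesis.Theorems.LacunarySymmetroidMatrixDescartes
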